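import Summits.CriticalPhenomena.PercolationContinuityZ3.Theorems.PercNearOneGluingNoHeavyPcintVdBEFibreBasic
import HarnessLib

/-!
# PCINT lane, king route, K1 step (3a): the fibres of van den Berg–Ermakov's `ξ`-process factorise

Cell `prim-pcint`, seat `prim-pcint-1` (gen 10); memo `run/shared/lean/prim/pcint/KING-ROUTE.md` §K1 (3).

The structural ("Markov") half of K1 step (3) for the oracle `VdBEProcess11.outVdBE11` (root rule `ε(o) = (1,1)`),
run with the cluster exploration `ClusterExpl.rule` on a finite `Λ ⊆ ℤ²` (fibre tests `VdBEMarkov.Fib` of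
`…PcintVdBEFibreBasic.lean`).

**Theorem (`StepCtx.DCtx.fib_mixG_iff`, `StepCtx.fib_mixG_iff_root`).**  Let `σ` be its own `n`-step replay with
selected site `b₂`, examined at step `k₀` by `c` (`StepCtx`); let `B` = the sites examined by `c`, `C` = the children
of `b₂`, and `W₀ = {b₂, c} ∪ C ∪ {b ∈ B | σ b = ff}`.  If `c ≠ o` was examined at step `k₁` by `d` (`DCtx`), then for
all `u w`,

  `Fib (mixG W₀ u w) ↔ FibRest w ∧ η(b₂,c)(u b₂, u c) ∧ η(c,d)(u c, w d) ∧ (∀ failed b ∈ B, ¬η(b,c)(u b, u c))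
     ∧ (∀ successful b ∈ B ∖ {b₂}, η(b,c)(w b, u c))`,

where `FibRest w` (the tests with `k ≠ k₀`, `a ≠ c`) does not read `W₀`; if `c = o` the `d`-conjunct is `u c = (1,1)`.
Ingredients: sites are examined once and selected once (`…ClusterExplorationRun`), children are unrevealed, failed
sites are never selected.  The analytic half (resampling `W₀`, matching with `VdBELocal.lawN`) is K1 step (3b).
-/

namespace Summit.CriticalPhenomena.PercolationContinuityZ3.Theorems.Pcint

namespace VdBEMarkov

open Finset AdaptDom ClusterExpl KingPairs VdBEProcess VdBEProcess11 VdBELocal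
  Literature.Probability.Percolation Literature.Probability.LatticeModels

variable {Λ : Finset (Site 2)} (enc : ↥Λ → ℕ) (o : ↥Λ)

/-! ### The step context: selected site `b₂`, its examiner `c` -/

/-- **Step context** (hypothesis structure of this file, not a cited notion): a state `σ` equal to its own `n`-step
replay, with selected site `b₂`, which was examined at the earlier step `k₀` from the site `c` selected then. -/
structure StepCtx where
  /-- number of steps -/
  n : ℕ
  /-- the state -/
  σ : ↥Λ → Option Bool
  /-- the selected site of `σ` (parent of the children examined next) -/
  b₂ : ↥Λ
  /-- the step at which `b₂` was examined -/
  k₀ : ℕ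
  /-- the examiner of `b₂` -/
  c : ↥Λ
  /-- `σ` is its own replay -/
  hcons : traj enc o σ n = σ
  /-- `b₂` is selected at `σ` -/
  hsel : sel (boxGraph Λ) enc σ = some b₂
  /-- `k₀` is before `n` -/
  hk₀ : k₀ < n
  /-- `c` is selected at step `k₀` -/
  hselc : sel (boxGraph Λ) enc (traj enc o σ k₀) = some c
  /-- `b₂` is examined at step `k₀` -/
  hb₂ : b₂ ∈ rule (boxGraph Λ) enc o (traj enc o σ k₀)

variable {enc o} (X : StepCtx enc o)

namespace StepCtx

/-- The sites examined by `c` (at step `k₀`). -/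
noncomputable def B : Finset ↥Λ := rule (boxGraph Λ) enc o (traj enc o X.σ X.k₀)

/-- The children of `b₂` (examined next). -/
noncomputable def C : Finset ↥Λ := rule (boxGraph Λ) enc o X.σ

/-- The failed brothers: sites examined by `c` and revealed `false`. -/
noncomputable def Bf : Finset ↥Λ := X.B.filter fun b => X.σ b = some false

/-- The resampled set `W₀ = {b₂, c} ∪ C ∪ Bf`. -/
noncomputable def W₀ : Finset ↥Λ := insert X.b₂ (insert X.c (X.C ∪ X.Bf))

/-- The fibre tests NOT touching `W₀` (a predicate of this file, not a cited fact): those at steps `k ≠ k₀` on sites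
`a ≠ c`. -/
def FibRest (w : ↥Λ → PState) : Prop :=
  ∀ k < X.n, ∀ a ∈ rule (boxGraph Λ) enc o (traj enc o X.σ k), k ≠ X.k₀ → a ≠ X.c →
    outVdBE11 Λ enc w (traj enc o X.σ k) a = (X.σ a).getD false

/-- The state at step `k₀` is not initial. -/
theorem not_init₀ : ¬ ∀ v, traj enc o X.σ X.k₀ v = none := fun h => by
  have := (sel_revealedTrue (boxGraph Λ) enc X.hselc).1; rw [h X.c] at this; exact absurd this (by simp)

/-- `k₀ ≥ 1`. -/
theorem one_le_k₀ : 1 ≤ X.k₀ := Nat.pos_of_ne_zero fun h => X.not_init₀ fun v => by rw [h]; rfl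

/-- `n ≥ 1`. -/
theorem one_le_n : 1 ≤ X.n := le_trans X.one_le_k₀ X.hk₀.le
/-- `σ` is not initial. -/
theorem not_init : ¬ ∀ v, X.σ v = none := fun h => by
  have := (sel_revealedTrue (boxGraph Λ) enc X.hsel).1; rw [h X.b₂] at this; exact absurd this (by simp)

/-- `b₂` is revealed true. -/
theorem σ_b₂ : X.σ X.b₂ = some true := (sel_revealedTrue (boxGraph Λ) enc X.hsel).1
/-- `c` is revealed true at step `k₀`. -/
theorem traj_c : traj enc o X.σ X.k₀ X.c = some true := (sel_revealedTrue (boxGraph Λ) enc X.hselc).1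

/-- Values revealed at step `k ≤ n` persist to `σ`. -/
theorem σ_eq_of_traj {k : ℕ} (hk : k ≤ X.n) {v : ↥Λ} (hv : traj enc o X.σ k v ≠ none) : X.σ v = traj enc o X.σ k v := by
  have := run_apply_of_ne_none (rule_unrevealed (boxGraph Λ) enc o) (readOut X.σ) hv X.n hk
  exact (congrFun X.hcons v).symm.trans this

/-- `c` is revealed true at `σ`. -/
theorem σ_c : X.σ X.c = some true := by
  rw [X.σ_eq_of_traj X.hk₀.le (by rw [X.traj_c]; simp), X.traj_c]

/-- The sites of `B` are unrevealed at step `k₀` and adjacent to `c`. -/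
theorem mem_B {b : ↥Λ} (hb : b ∈ X.B) : traj enc o X.σ X.k₀ b = none ∧ (zdGraph 2).Adj X.c.1 b.1 := by
  have h := hb
  unfold B at h
  rw [rule_eq_filter_of_sel (boxGraph Λ) enc o X.not_init₀ X.hselc, mem_filter] at h
  exact ⟨h.2.2, h.2.1⟩

/-- `c` is adjacent to `b₂`. -/
theorem adj_c_b₂ : (zdGraph 2).Adj X.c.1 X.b₂.1 := (X.mem_B X.hb₂).2

/-- The sites of `B` are revealed at `σ`, with the value reported at step `k₀`. -/
theorem σ_of_mem_B {b : ↥Λ} (hb : b ∈ X.B) :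
    X.σ b = some (readOut X.σ (traj enc o X.σ X.k₀) b) := by
  have := run_apply_eq_of_mem_rule (boxGraph Λ) enc o (readOut X.σ) hb X.hk₀
  exact (congrFun X.hcons b).symm.trans this

/-- The children are unrevealed at `σ` and adjacent to `b₂`. -/
theorem mem_C {a : ↥Λ} (ha : a ∈ X.C) : X.σ a = none ∧ (zdGraph 2).Adj X.b₂.1 a.1 := by
  have h := ha
  unfold C at h
  rw [rule_eq_filter_of_sel (boxGraph Λ) enc o X.not_init X.hsel, mem_filter] at h
  exact ⟨h.2.2, h.2.1⟩

/-- The root is revealed at every step `k ≥ 1`. -/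
theorem traj_o_ne_none {k : ℕ} (hk : 1 ≤ k) : traj enc o X.σ k o ≠ none :=
  run_root_ne_none (boxGraph Λ) enc o (readOut X.σ) k hk

/-- No site of `B` is the root. -/
theorem ne_o_of_mem_B {b : ↥Λ} (hb : b ∈ X.B) : b ≠ o := fun h => by
  have := (X.mem_B hb).1; rw [h] at this; exact X.traj_o_ne_none X.one_le_k₀ this

/-- `b₂ ≠ o`. -/
theorem b₂_ne_o : X.b₂ ≠ o := X.ne_o_of_mem_B X.hb₂

/-- No child is the root. -/
theorem ne_o_of_mem_C {a : ↥Λ} (ha : a ∈ X.C) : a ≠ o := fun h => by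
  have h1 : X.σ o = none := h ▸ (X.mem_C ha).1
  exact X.traj_o_ne_none X.one_le_n ((congrFun X.hcons o).trans h1)

/-- No site of `B` is `c`. -/
theorem ne_c_of_mem_B {b : ↥Λ} (hb : b ∈ X.B) : b ≠ X.c := fun h => by
  have h1 := (X.mem_B hb).1
  rw [h, X.traj_c] at h1; exact absurd h1 (by simp)

/-- `b₂ ≠ c`. -/
theorem b₂_ne_c : X.b₂ ≠ X.c := X.ne_c_of_mem_B X.hb₂

/-- A child is neither `b₂` nor `c` nor in `B`. -/
theorem mem_C_ne {a : ↥Λ} (ha : a ∈ X.C) : a ≠ X.b₂ ∧ a ≠ X.c ∧ a ∉ X.B := by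
  have h0 := (X.mem_C ha).1
  refine ⟨fun h => ?_, fun h => ?_, fun h => ?_⟩
  · rw [h, X.σ_b₂] at h0; exact absurd h0 (by simp)
  · rw [h, X.σ_c] at h0; exact absurd h0 (by simp)
  · rw [X.σ_of_mem_B h] at h0; exact absurd h0 (by simp)

/-- A failed brother is in `B`, revealed false, and is neither `b₂` nor `c` nor a child. -/
theorem mem_Bf {b : ↥Λ} (hb : b ∈ X.Bf) : b ∈ X.B ∧ X.σ b = some false ∧ b ≠ X.b₂ ∧ b ≠ X.c ∧ b ∉ X.C := by
  obtain ⟨hB, hf⟩ := mem_filter.1 hb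
  refine ⟨hB, hf, fun h => ?_, fun h => ?_, fun h => ?_⟩
  · rw [h, X.σ_b₂] at hf; exact absurd hf (by simp)
  · rw [h, X.σ_c] at hf; exact absurd hf (by simp)
  · have := (X.mem_C h).1; rw [hf] at this; exact absurd this (by simp)

/-- Membership in `W₀`, unfolded. -/
theorem mem_W₀ {v : ↥Λ} : v ∈ X.W₀ ↔ v = X.b₂ ∨ v = X.c ∨ v ∈ X.C ∨ v ∈ X.Bf := by
  unfold W₀; simp only [mem_insert, mem_union]

/-- A site revealed true at `σ`, other than `b₂` and `c`, is not in `W₀`. -/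
theorem not_mem_W₀_of_true {v : ↥Λ} (hv : X.σ v = some true) (h1 : v ≠ X.b₂) (h2 : v ≠ X.c) : v ∉ X.W₀ := by
  rw [X.mem_W₀]
  rintro (h | h | h | h)
  · exact h1 h
  · exact h2 h
  · have := (X.mem_C h).1; rw [hv] at this; exact absurd this (by simp)
  · have := (X.mem_Bf h).2.1; rw [hv] at this; exact absurd this (by simp)

/-- **A site examined at a step `k ≠ k₀`, other than `c`, is not in `W₀`** (examined once; children unrevealed). -/
theorem not_mem_W₀_of_examined {k : ℕ} (hk : k < X.n) (hk₀ : k ≠ X.k₀) {a : ↥Λ}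
    (ha : a ∈ rule (boxGraph Λ) enc o (traj enc o X.σ k)) (hac : a ≠ X.c) : a ∉ X.W₀ := by
  rw [X.mem_W₀]
  rintro (h | h | h | h)
  · exact hk₀ (step_unique_of_mem_rule (boxGraph Λ) enc o (readOut X.σ) ha (h ▸ X.hb₂))
  · exact hac h
  · have h0 := (X.mem_C h).1
    rw [← X.hcons] at h0
    exact not_mem_rule_of_run_apply_eq_none (boxGraph Λ) enc o (readOut X.σ) hk h0 ha
  · exact hk₀ (step_unique_of_mem_rule (boxGraph Λ) enc o (readOut X.σ) ha (X.mem_Bf h).1)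

/-- **A site selected at a step `1 ≤ k < n`, `k ≠ k₀`, is not in `W₀`** (selected once; selected sites are revealed
true). -/
theorem not_mem_W₀_of_sel {k : ℕ} (hk1 : 1 ≤ k) (hk : k < X.n) (hk₀ : k ≠ X.k₀) {b : ↥Λ}
    (hb : sel (boxGraph Λ) enc (traj enc o X.σ k) = some b) : b ∉ X.W₀ := by
  have hne : ¬ ∀ v, traj enc o X.σ k v = none := by
    obtain ⟨k', rfl⟩ := Nat.exists_eq_add_of_le' hk1
    exact not_initial_run_succ (boxGraph Λ) enc o (readOut X.σ) k'
  have hbT : X.σ b = some true := by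
    have h1 := (sel_revealedTrue (boxGraph Λ) enc hb).1
    rw [X.σ_eq_of_traj hk.le (by rw [h1]; simp), h1]
  refine X.not_mem_W₀_of_true hbT (fun h => ?_) (fun h => ?_)
  · have := sel_ne_of_sel_eq (boxGraph Λ) enc o (readOut X.σ) hne hb hk
    rw [h] at this
    have h2 := X.hsel; rw [← X.hcons] at h2
    exact this h2
  · rw [h] at hb
    rcases Nat.lt_or_gt_of_ne hk₀ with hlt | hlt
    · exact sel_ne_of_sel_eq (boxGraph Λ) enc o (readOut X.σ) hne hb hlt X.hselc
    · exact sel_ne_of_sel_eq (boxGraph Λ) enc o (readOut X.σ) X.not_init₀ X.hselc hlt hb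

/-- **The tests of `FibRest` do not read `W₀`.** -/
theorem fibRest_mixG_iff (u w : ↥Λ → PState) : X.FibRest (mixG X.W₀ u w) ↔ X.FibRest w := by
  have key : ∀ k < X.n, ∀ a ∈ rule (boxGraph Λ) enc o (traj enc o X.σ k), k ≠ X.k₀ → a ≠ X.c →
      outVdBE11 Λ enc (mixG X.W₀ u w) (traj enc o X.σ k) a = outVdBE11 Λ enc w (traj enc o X.σ k) a := by
    intro k hk a ha hk₀ hac
    have haW := X.not_mem_W₀_of_examined hk hk₀ ha hac
    rcases Nat.eq_zero_or_pos k with rfl | hk1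
    · -- root step: `a = o`
      have hinit : ∀ v, traj enc o X.σ 0 v = none := fun v => rfl
      rw [outVdBE11_init enc (mixG X.W₀ u w) hinit, outVdBE11_init enc w hinit, mixG_of_not_mem haW]
    · have hne : ¬ ∀ v, traj enc o X.σ k v = none := by
        obtain ⟨k', rfl⟩ := Nat.exists_eq_add_of_le' hk1
        exact not_initial_run_succ (boxGraph Λ) enc o (readOut X.σ) k'
      cases hs : sel (boxGraph Λ) enc (traj enc o X.σ k) with
      | none => rw [outVdBE11_none enc _ hne hs, outVdBE11_none enc _ hne hs]
      | some b =>
        have hbW := X.not_mem_W₀_of_sel hk1 hk hk₀ hs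
        have hab : (zdGraph 2).Adj a.1 b.1 := by
          rw [rule_eq_filter_of_sel (boxGraph Λ) enc o hne hs, mem_filter] at ha
          exact ((boxGraph_adj Λ).1 ha.2.1).symm
        rw [outVdBE11_sel enc _ hne hs hab, outVdBE11_sel enc _ hne hs hab, mixG_of_not_mem haW,
          mixG_of_not_mem hbW]
  constructor
  · intro h k hk a ha hk₀ hac; rw [← key k hk a ha hk₀ hac]; exact h k hk a ha hk₀ hac
  · intro h k hk a ha hk₀ hac; rw [key k hk a ha hk₀ hac]; exact h k hk a ha hk₀ hac

/-- Splitting the fibre tests into `FibRest`, the tests on `B` (step `k₀`), and the tests on `c`. -/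
theorem fib_iff_rest (w : ↥Λ → PState) : Fib enc o X.n X.σ w ↔ X.FibRest w ∧
    (∀ b ∈ X.B, outVdBE11 Λ enc w (traj enc o X.σ X.k₀) b = (X.σ b).getD false) ∧
    (∀ k < X.n, X.c ∈ rule (boxGraph Λ) enc o (traj enc o X.σ k) →
      outVdBE11 Λ enc w (traj enc o X.σ k) X.c = (X.σ X.c).getD false) := by
  constructor
  · intro h
    exact ⟨fun k hk a ha _ _ => h k hk a ha, fun b hb => h X.k₀ X.hk₀ b hb, fun k hk hc => h k hk X.c hc⟩
  · rintro ⟨h1, h2, h3⟩ k hk a ha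
    by_cases hk₀ : k = X.k₀
    · subst hk₀; exact h2 a ha
    · by_cases hac : a = X.c
      · subst hac; exact h3 k hk ha
      · exact h1 k hk a ha hk₀ hac

/-- The tests on `B` at the mixed assignment: `η(b, c)` with `c` read from `u`, `b` read from `u` if `b = b₂` or `b`
failed, from `w` otherwise. -/
theorem testB_mixG_iff (u w : ↥Λ → PState) :
    (∀ b ∈ X.B, outVdBE11 Λ enc (mixG X.W₀ u w) (traj enc o X.σ X.k₀) b = (X.σ b).getD false) ↔
      etaB X.b₂.1 X.c.1 (u X.b₂) (u X.c) = true ∧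
      (∀ b ∈ X.B, X.σ b = some false → etaB b.1 X.c.1 (u b) (u X.c) = false) ∧
      (∀ b ∈ X.B, b ≠ X.b₂ → X.σ b = some true → etaB b.1 X.c.1 (w b) (u X.c) = true) := by
  have hcW : X.c ∈ X.W₀ := X.mem_W₀.2 (Or.inr (Or.inl rfl))
  have hb₂W : X.b₂ ∈ X.W₀ := X.mem_W₀.2 (Or.inl rfl)
  have ev : ∀ b ∈ X.B, outVdBE11 Λ enc (mixG X.W₀ u w) (traj enc o X.σ X.k₀) b =
      etaB b.1 X.c.1 (mixG X.W₀ u w b) (u X.c) := by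
    intro b hb
    rw [outVdBE11_sel enc _ X.not_init₀ X.hselc (X.mem_B hb).2.symm, mixG_of_mem hcW]
  constructor
  · intro h
    refine ⟨?_, fun b hb hf => ?_, fun b hb hne ht => ?_⟩
    · have := h X.b₂ X.hb₂
      rw [ev X.b₂ X.hb₂, mixG_of_mem hb₂W, X.σ_b₂] at this; exact this
    · have hbW : b ∈ X.W₀ := X.mem_W₀.2 (Or.inr (Or.inr (Or.inr (mem_filter.2 ⟨hb, hf⟩))))
      have := h b hb
      rw [ev b hb, mixG_of_mem hbW, hf] at this; exact this
    · have hbW : b ∉ X.W₀ := X.not_mem_W₀_of_true ht hne (X.ne_c_of_mem_B hb)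
      have := h b hb
      rw [ev b hb, mixG_of_not_mem hbW, ht] at this; exact this
  · rintro ⟨h1, h2, h3⟩ b hb
    rw [ev b hb]
    by_cases hbb : b = X.b₂
    · subst hbb; rw [mixG_of_mem hb₂W, X.σ_b₂]; exact h1
    · have hσb := X.σ_of_mem_B hb
      cases hv : readOut X.σ (traj enc o X.σ X.k₀) b with
      | false =>
        rw [hv] at hσb
        have hbW : b ∈ X.W₀ := X.mem_W₀.2 (Or.inr (Or.inr (Or.inr (mem_filter.2 ⟨hb, hσb⟩))))
        rw [mixG_of_mem hbW, hσb]; exact h2 b hb hσb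
      | true =>
        rw [hv] at hσb
        rw [mixG_of_not_mem (X.not_mem_W₀_of_true hσb hbb (X.ne_c_of_mem_B hb)), hσb]; exact h3 b hb hbb hσb

/-! #### The examiner `d` of `c` (case `c ≠ o`) -/

/-- **Examiner context** (hypothesis structure of this file): `c` was examined at the step `k₁ < k₀` from the site `d`
selected then (this is the case `c ≠ o`). -/
structure DCtx where
  /-- the step at which `c` was examined -/
  k₁ : ℕ
  /-- the examiner of `c` -/
  d : ↥Λ
  /-- `k₁` is before `k₀` -/
  hk₁ : k₁ < X.k₀
  /-- `d` is selected at step `k₁` -/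
  hseld : sel (boxGraph Λ) enc (traj enc o X.σ k₁) = some d
  /-- `c` is examined at step `k₁` -/
  hc : X.c ∈ rule (boxGraph Λ) enc o (traj enc o X.σ k₁)

variable {X} (D : X.DCtx)

/-- The state at step `k₁` is not initial. -/
theorem DCtx.not_init₁ : ¬ ∀ v, traj enc o X.σ D.k₁ v = none := fun h => by
  have := (sel_revealedTrue (boxGraph Λ) enc D.hseld).1
  rw [h D.d] at this; exact absurd this (by simp)

/-- `k₁ ≥ 1`. -/
theorem DCtx.one_le_k₁ : 1 ≤ D.k₁ := Nat.pos_of_ne_zero fun h => D.not_init₁ fun v => by rw [h]; rfl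

/-- `d` is adjacent to `c`. -/
theorem DCtx.adj_d_c : (zdGraph 2).Adj D.d.1 X.c.1 := by
  have h := D.hc
  rw [rule_eq_filter_of_sel (boxGraph Λ) enc o D.not_init₁ D.hseld, mem_filter] at h
  exact (boxGraph_adj Λ).1 h.2.1

/-- `d ∉ W₀`. -/
theorem DCtx.d_not_mem_W₀ : D.d ∉ X.W₀ :=
  X.not_mem_W₀_of_sel D.one_le_k₁ (D.hk₁.trans X.hk₀) (ne_of_lt D.hk₁) D.hseld

/-- `c` is examined only at step `k₁`. -/
theorem DCtx.eq_k₁ {k : ℕ} (hk : X.c ∈ rule (boxGraph Λ) enc o (traj enc o X.σ k)) : k = D.k₁ :=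
  step_unique_of_mem_rule (boxGraph Λ) enc o (readOut X.σ) hk D.hc

/-- The test on `c` at the mixed assignment: `η(c, d)` with `c` read from `u` and `d` from `w`. -/
theorem DCtx.testC_mixG_iff (u w : ↥Λ → PState) :
    (∀ k < X.n, X.c ∈ rule (boxGraph Λ) enc o (traj enc o X.σ k) →
      outVdBE11 Λ enc (mixG X.W₀ u w) (traj enc o X.σ k) X.c = (X.σ X.c).getD false) ↔
      etaB X.c.1 D.d.1 (u X.c) (w D.d) = true := by
  have hcW : X.c ∈ X.W₀ := X.mem_W₀.2 (Or.inr (Or.inl rfl))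
  have ev : outVdBE11 Λ enc (mixG X.W₀ u w) (traj enc o X.σ D.k₁) X.c = etaB X.c.1 D.d.1 (u X.c) (w D.d) := by
    rw [outVdBE11_sel enc _ D.not_init₁ D.hseld D.adj_d_c.symm, mixG_of_mem hcW, mixG_of_not_mem D.d_not_mem_W₀]
  constructor
  · intro h
    have := h D.k₁ (D.hk₁.trans X.hk₀) D.hc
    rw [ev, X.σ_c] at this; exact this
  · intro h k _ hk
    have := D.eq_k₁ hk; subst this
    rw [ev, X.σ_c]; exact h

/-- **Fibre factorisation, case `c ≠ o`**: on the mixed assignment `mixG W₀ u w` the fibre tests split into the tests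
not reading `W₀` (evaluated at `w`) and four explicit `η`-conditions on the pair states of `b₂, c` (from `u`), `d`
(from `w`), the failed brothers (from `u`) and the successful brothers (from `w`). -/
theorem DCtx.fib_mixG_iff (u w : ↥Λ → PState) :
    Fib enc o X.n X.σ (mixG X.W₀ u w) ↔ X.FibRest w ∧
      (etaB X.b₂.1 X.c.1 (u X.b₂) (u X.c) = true ∧ etaB X.c.1 D.d.1 (u X.c) (w D.d) = true ∧
        (∀ b ∈ X.B, X.σ b = some false → etaB b.1 X.c.1 (u b) (u X.c) = false) ∧
        (∀ b ∈ X.B, b ≠ X.b₂ → X.σ b = some true → etaB b.1 X.c.1 (w b) (u X.c) = true)) := by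
  rw [X.fib_iff_rest, X.fibRest_mixG_iff, X.testB_mixG_iff, D.testC_mixG_iff]
  tauto

/-! #### The root case `c = o` -/

/-- The test on `c = o` at the mixed assignment: the root rule `u c = (1,1)`. -/
theorem testC_mixG_iff_root (hco : X.c = o) (u w : ↥Λ → PState) :
    (∀ k < X.n, X.c ∈ rule (boxGraph Λ) enc o (traj enc o X.σ k) →
      outVdBE11 Λ enc (mixG X.W₀ u w) (traj enc o X.σ k) X.c = (X.σ X.c).getD false) ↔
      u X.c = (true, true) := by
  have hcW : X.c ∈ X.W₀ := X.mem_W₀.2 (Or.inr (Or.inl rfl))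
  have h00 : ∀ v, traj enc o X.σ 0 v = none := fun _ => rfl
  have ev : outVdBE11 Λ enc (mixG X.W₀ u w) (traj enc o X.σ 0) X.c = decide (u X.c = (true, true)) := by
    rw [outVdBE11_init enc _ h00, mixG_of_mem hcW]
  have h0 : X.c ∈ rule (boxGraph Λ) enc o (traj enc o X.σ 0) := by rw [hco]; exact root_mem_rule_zero enc o X.σ
  constructor
  · intro h
    have := h 0 X.one_le_n h0
    rw [ev, X.σ_c] at this; exact of_decide_eq_true this
  · intro h k _ hk
    have := step_unique_of_mem_rule (boxGraph Λ) enc o (readOut X.σ) hk h0; subst this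
    rw [ev, X.σ_c]; exact decide_eq_true h

/-- **Fibre factorisation, root case `c = o`**: as `fib_mixG_iff`, with the root rule `u c = (1,1)` in place of the
`d`-condition. -/
theorem fib_mixG_iff_root (hco : X.c = o) (u w : ↥Λ → PState) :
    Fib enc o X.n X.σ (mixG X.W₀ u w) ↔ X.FibRest w ∧
      (etaB X.b₂.1 X.c.1 (u X.b₂) (u X.c) = true ∧ u X.c = (true, true) ∧
        (∀ b ∈ X.B, X.σ b = some false → etaB b.1 X.c.1 (u b) (u X.c) = false) ∧
        (∀ b ∈ X.B, b ≠ X.b₂ → X.σ b = some true → etaB b.1 X.c.1 (w b) (u X.c) = true)) := by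
  rw [X.fib_iff_rest, X.fibRest_mixG_iff, X.testB_mixG_iff, X.testC_mixG_iff_root hco]
  tauto

end StepCtx

end VdBEMarkov

end Summit.CriticalPhenomena.PercolationContinuityZ3.Theorems.Pcint
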